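import Summits.FinalStateConjecture.FinalStateConjecture.Theorems.StarvedNecksNecksCertifyStubKirchhoffFormula
import Summits.FinalStateConjecture.FinalStateConjecture.Theorems.StarvedNecksNecksCertifyStubSphericalMeansCalculus
import Summits.FinalStateConjecture.FinalStateConjecture.Theorems.StarvedNecksNecksCertifyStubSphereMeanDarboux

/-!
# Route StarvedNecks — crux `NecksCertify`, line `two-cap-focusing-ledger`: dispersive `t⁻¹` decay

Registered helper sub-goal `stub_neckLedgerAnalysis_dispersiveDecay` of the physics stub
`stub_neckLedgerAnalysis`: the classical **uniform `t⁻¹` decay of free waves on `ℝ¹⁺³` with smooth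
compactly supported Cauchy data** (Evans, *PDE*, §2.4.1(c); Sogge, *Lectures on nonlinear wave
equations*, Ch. I, Thm. 1.1), read off the LANDED Kirchhoff–Duhamel representation
(`Kirchhoff.stub_kirchhoffFormula`, rung R1b, composed with the landed rungs R1a-ii
`SphericalMeans.stub_sphericalMeansCalculus` and R1a-i `Darboux.stub_sphereMeanDarboux` into the
unconditional formula, inlined in the proof).

For a smooth `ψ : E4 → ℝ` with `□_η ψ = 0` everywhere whose data `(ψ, Dψ)(0, ·)` vanish outside the
closed ball of radius `R > 0` there is `C = C(ψ, R)` with `|ψ(t, x)| ≤ C / t` for all `x` and all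
`t ≥ 2R + 1`.  PROOF.  Kirchhoff at the apex `(t, x)` with radius `σ = t`:
`ψ(t,x) = ⨍ ψ(0, x + tw) + t ⨍ Dψ(0, x + tw)(1, w)` (the Duhamel term vanishes with `□_ηψ`).  Both
integrands vanish unless `‖x + tw‖ ≤ R`, i.e. unless `w` lies in the spherical CAP
`K = {w ∈ S² : ‖w − p‖ ≤ R/t}`, `p = −t⁻¹x`, and they are bounded by the (finite) sups `A` of
`|ψ(0, ·)|` and `2B`, `B = sup ‖Dψ(0, ·)‖` (`‖(1, w)‖ ≤ 2`); hence `|ψ(t,x)| ≤ (A + 2tB) σ(K)/σ(S²)`.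
The CAP MEASURE LEMMA `σ{w ∈ S² : ‖w − p‖ ≤ ε} ≤ 162 ε² vol(B³)` for `0 < ε ≤ 1` (`toSphere_cap_le`)
is proved from `σ(K) = 3 vol((0,1)·K)` (`Measure.toSphere_apply'`) by covering the solid sector
`(0,1)·K` with `⌊1/ε⌋ + 1` balls of radius `3ε` strung along the axis through a point of `K`.  With
`ε = R/t` this gives `|ψ(t,x)| ≤ 162 R² vol(B³) (A/t² + 2B/t)/σ(S²) ≤ C/t` for `t ≥ 1`.
Mathlib and the three landed R1 modules only; no definitions, no named facts.
-/

noncomputable section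

open scoped Manifold ContDiff Topology ENNReal Pointwise
open Filter Set MeasureTheory Topology Literature.Geometry.Lorentzian

-- the doubled `FinalStateConjecture.FinalStateConjecture` path component trips dupNamespace
set_option linter.dupNamespace false

namespace Summit.FinalStateConjecture.FinalStateConjecture.Theorems.NecksCertifyTwoCap.Dispersive

/-! ### The cap measure lemma -/

/-- **Cap measure lemma.**  The sphere measure of the cap `K = {w ∈ S² : ‖w − p‖ ≤ ε}`
(`0 < ε ≤ 1`, any `p ∈ ℝ³`) is at most `162 ε² · vol(B³)`: by `Measure.toSphere_apply'` it is
`3 vol((0,1)·K)`, and if `w₀ ∈ K` then every point `r w` of the solid sector (`0 < r < 1`, `w ∈ K`,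
so `‖w − w₀‖ ≤ 2ε`) is within `3ε` of the point `⌊r/ε⌋ ε w₀` of the axis, so the sector is covered
by `⌊1/ε⌋ + 1` balls of radius `3ε`, of total volume `≤ (1/ε + 1) (3ε)³ vol(B³) ≤ 54 ε² vol(B³)`. -/
theorem toSphere_cap_le (p : E3) {ε : ℝ} (hε : 0 < ε) (hε1 : ε ≤ 1) :
    (volume : Measure E3).toSphere {w : Metric.sphere (0 : E3) 1 | ‖(w : E3) - p‖ ≤ ε} ≤
      ENNReal.ofReal (162 * ε ^ 2) * volume (Metric.ball (0 : E3) 1) := by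
  set K : Set (Metric.sphere (0 : E3) 1) := {w | ‖(w : E3) - p‖ ≤ ε}
  rcases K.eq_empty_or_nonempty with hKe | ⟨w₀, hw₀⟩
  · rw [hKe, measure_empty]
    exact zero_le
  have hw₀' : ‖(w₀ : E3) - p‖ ≤ ε := hw₀
  have hw₀1 : ‖(w₀ : E3)‖ = 1 := norm_eq_of_mem_sphere w₀
  have hKm : MeasurableSet K :=
    (isClosed_le (continuous_subtype_val.sub continuous_const).norm continuous_const).measurableSet
  have hdim : Module.finrank ℝ E3 = 3 := finrank_euclideanSpace_fin
  obtain ⟨N, hN⟩ : ∃ N : ℕ, N = ⌊1 / ε⌋₊ := ⟨_, rfl⟩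
  -- the solid sector over the cap is covered by `N + 1` balls of radius `3ε` along the axis `w₀`
  have hcover : Ioo (0 : ℝ) 1 • (((↑) : Metric.sphere (0 : E3) 1 → E3) '' K) ⊆
      ⋃ k ∈ Finset.range (N + 1), Metric.ball (((k : ℝ) * ε) • (w₀ : E3)) (3 * ε) := by
    rintro z ⟨r, hr, y, ⟨w, hw, rfl⟩, rfl⟩
    have hw' : ‖(w : E3) - p‖ ≤ ε := hw
    have hww₀ : ‖(w : E3) - w₀‖ ≤ 2 * ε := by
      calc ‖(w : E3) - w₀‖ = ‖((w : E3) - p) - ((w₀ : E3) - p)‖ := by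
            rw [sub_sub_sub_cancel_right]
        _ ≤ ‖(w : E3) - p‖ + ‖(w₀ : E3) - p‖ := norm_sub_le _ _
        _ ≤ 2 * ε := by linarith
    obtain ⟨k, hk⟩ : ∃ k : ℕ, k = ⌊r / ε⌋₊ := ⟨_, rfl⟩
    have hk1 : (k : ℝ) * ε ≤ r := by
      have h := Nat.floor_le (div_nonneg hr.1.le hε.le)
      rw [← hk, le_div_iff₀ hε] at h
      exact h
    have hk2 : r < (k : ℝ) * ε + ε := by
      have h := Nat.lt_floor_add_one (r / ε)
      rw [← hk, div_lt_iff₀ hε] at h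
      linarith
    have hkN : k ∈ Finset.range (N + 1) := by
      rw [Finset.mem_range, hk, hN]
      refine Nat.lt_succ_of_le (Nat.floor_le_floor ?_)
      gcongr
      exact hr.2.le
    refine mem_iUnion₂.2 ⟨k, hkN, ?_⟩
    change r • (w : E3) ∈ Metric.ball (((k : ℝ) * ε) • (w₀ : E3)) (3 * ε)
    rw [Metric.mem_ball, dist_eq_norm]
    have hsplit : r • (w : E3) - ((k : ℝ) * ε) • (w₀ : E3) =
        r • ((w : E3) - w₀) + (r - (k : ℝ) * ε) • (w₀ : E3) := by
      rw [smul_sub, sub_smul]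
      abel
    have h1 : r * ‖(w : E3) - w₀‖ ≤ 1 * (2 * ε) :=
      mul_le_mul hr.2.le hww₀ (norm_nonneg _) zero_le_one
    rw [hsplit]
    calc ‖r • ((w : E3) - w₀) + (r - (k : ℝ) * ε) • (w₀ : E3)‖
        ≤ ‖r • ((w : E3) - w₀)‖ + ‖(r - (k : ℝ) * ε) • (w₀ : E3)‖ := norm_add_le _ _
      _ = r * ‖(w : E3) - w₀‖ + (r - (k : ℝ) * ε) := by
          rw [norm_smul, norm_smul, hw₀1, mul_one, Real.norm_of_nonneg hr.1.le,
            Real.norm_of_nonneg (sub_nonneg.2 hk1)]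
      _ < 3 * ε := by linarith
  -- each ball has volume `(3ε)³ vol(B³)`
  have h3ε : 0 < 3 * ε := by positivity
  have hball : ∀ k : ℕ, volume (Metric.ball (((k : ℝ) * ε) • (w₀ : E3)) (3 * ε)) =
      ENNReal.ofReal ((3 * ε) ^ 3) * volume (Metric.ball (0 : E3) 1) := fun k ↦ by
    rw [Measure.addHaar_ball_of_pos volume _ h3ε, hdim]
  have hfin : (Module.finrank ℝ E3 : ℝ≥0∞) = ENNReal.ofReal 3 := by
    rw [hdim]
    simp
  -- `(N + 1) ε ≤ 2`, so the total volume is `≤ 54 ε² vol(B³)`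
  have hNε : (N : ℝ) * ε ≤ 1 := by
    have h := Nat.floor_le (show (0 : ℝ) ≤ 1 / ε by positivity)
    rw [← hN, le_div_iff₀ hε] at h
    exact h
  have hreal : 3 * ((N + 1 : ℕ) : ℝ) * (3 * ε) ^ 3 ≤ 162 * ε ^ 2 := by
    push_cast
    nlinarith [mul_le_mul_of_nonneg_left (show (N : ℝ) * ε + ε ≤ 2 by linarith)
      (show (0 : ℝ) ≤ 81 * ε ^ 2 by positivity)]
  rw [Measure.toSphere_apply' _ hKm]
  calc (Module.finrank ℝ E3 : ℝ≥0∞) *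
        volume (Ioo (0 : ℝ) 1 • (((↑) : Metric.sphere (0 : E3) 1 → E3) '' K))
      ≤ (Module.finrank ℝ E3 : ℝ≥0∞) *
          ∑ k ∈ Finset.range (N + 1), volume (Metric.ball (((k : ℝ) * ε) • (w₀ : E3)) (3 * ε)) :=
        mul_le_mul_right ((measure_mono hcover).trans (measure_biUnion_finset_le _ _)) _
    _ = ENNReal.ofReal (3 * ((N + 1 : ℕ) : ℝ) * (3 * ε) ^ 3) * volume (Metric.ball (0 : E3) 1) := by
        simp only [hball, Finset.sum_const, Finset.card_range, nsmul_eq_mul]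
        rw [hfin, ← ENNReal.ofReal_natCast (N + 1),
          ENNReal.ofReal_mul (by positivity : (0 : ℝ) ≤ 3 * ((N + 1 : ℕ) : ℝ)),
          ENNReal.ofReal_mul (by norm_num : (0 : ℝ) ≤ 3)]
        ring
    _ ≤ ENNReal.ofReal (162 * ε ^ 2) * volume (Metric.ball (0 : E3) 1) :=
        mul_le_mul_left (ENNReal.ofReal_le_ofReal hreal) _

/-- The cap lemma in the form used below: for `0 < R ≤ t`, the set of directions `w ∈ S²` with
`‖x + t w‖ ≤ R` is the cap of radius `R/t ≤ 1` about `−t⁻¹x`, so its sphere measure is at most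
`162 (R/t)² vol(B³)`. -/
theorem toSphere_focus_real_le (x : E3) {R t : ℝ} (hR : 0 < R) (hRt : R ≤ t) :
    ((volume : Measure E3).toSphere
        {w : Metric.sphere (0 : E3) 1 | ‖x + t • (w : E3)‖ ≤ R}).toReal ≤
      162 * (R / t) ^ 2 * (volume (Metric.ball (0 : E3) 1)).toReal := by
  have ht0 : 0 < t := hR.trans_le hRt
  have hset : {w : Metric.sphere (0 : E3) 1 | ‖x + t • (w : E3)‖ ≤ R} =
      {w : Metric.sphere (0 : E3) 1 | ‖(w : E3) - (-(t⁻¹ • x))‖ ≤ R / t} := by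
    ext w
    simp only [mem_setOf_eq, sub_neg_eq_add]
    rw [show x + t • (w : E3) = t • ((w : E3) + t⁻¹ • x) by
        rw [smul_add, smul_smul, mul_inv_cancel₀ ht0.ne', one_smul, add_comm],
      norm_smul, Real.norm_of_nonneg ht0.le, le_div_iff₀' ht0]
  rw [hset, ← ENNReal.toReal_ofReal (by positivity : (0 : ℝ) ≤ 162 * (R / t) ^ 2),
    ← ENNReal.toReal_mul]
  exact ENNReal.toReal_mono (ENNReal.mul_ne_top ENNReal.ofReal_ne_top measure_ball_lt_top.ne)
    (toSphere_cap_le _ (by positivity) ((div_le_one ht0).2 hRt))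

/-! ### The registered helper: uniform `t⁻¹` decay -/

/-- Registered helper sub-goal `stub_neckLedgerAnalysis_dispersiveDecay` of line
`two-cap-focusing-ledger` (crux `StarvedNecks.NecksCertify`): **uniform `t⁻¹` decay of free waves
on `ℝ¹⁺³`** (Evans, *PDE*, §2.4.1(c); von Wahl).  For smooth `ψ` with `□_ηψ = 0` and Cauchy data
`(ψ, Dψ)(0, ·)` vanishing outside the closed ball of radius `R > 0`, there is `C` with
`|ψ(t, x)| ≤ C/t` for all `x` and `t ≥ 2R + 1`: Kirchhoff's formula at the apex `(t, x)` with radius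
`t` has no Duhamel term, and its two sphere averages live on a cap of sphere measure `O((R/t)²)`
(`toSphere_focus_real_le`) where the integrands are bounded by the data sups `A` and `2B`, whence
`|ψ(t, x)| ≤ 162 R² vol(B³) (A/t² + 2B/t)/σ(S²) ≤ C/t`. -/
theorem stub_neckLedgerAnalysis_dispersiveDecay : ∀ (ψ : E4 → ℝ), ContDiff ℝ ∞ ψ → (∀ y : E4, KerrSchild.waveOperator (fun _ ↦ Kerr.etaComp) ψ y = 0) → ∀ (R : ℝ), 0 < R → (∀ y : E3, R < ‖y‖ → ψ (E4.ofTimeSpace 0 y) = 0 ∧ fderiv ℝ ψ (E4.ofTimeSpace 0 y) = 0) → ∃ C : ℝ, ∀ (t : ℝ) (x : E3), 2 * R + 1 ≤ t → |ψ (E4.ofTimeSpace t x)| ≤ C / t := by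
  intro ψ hψ hwave R hR hdata
  /- uniform bounds on the Cauchy data: `|ψ(0, ·)| ≤ A`, `‖Dψ(0, ·)‖ ≤ B` -/
  obtain ⟨A, hA0, hA⟩ : ∃ A : ℝ, 0 ≤ A ∧ ∀ y : E3, |ψ (E4.ofTimeSpace 0 y)| ≤ A := by
    have hcont : Continuous fun y : E3 ↦ ψ (E4.ofTimeSpace 0 y) :=
      hψ.continuous.comp (E4.continuous_ofTimeSpace 0)
    obtain ⟨A, hA⟩ :=
      (isCompact_closedBall (0 : E3) R).exists_bound_of_continuousOn hcont.continuousOn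
    have hA0 : 0 ≤ A := (norm_nonneg _).trans (hA 0 (Metric.mem_closedBall_self hR.le))
    refine ⟨A, hA0, fun y ↦ ?_⟩
    by_cases hy : ‖y‖ ≤ R
    · simpa only [Real.norm_eq_abs] using hA y (mem_closedBall_zero_iff.2 hy)
    · rw [(hdata y (not_le.1 hy)).1, abs_zero]
      exact hA0
  obtain ⟨B, hB0, hB⟩ : ∃ B : ℝ, 0 ≤ B ∧ ∀ y : E3, ‖fderiv ℝ ψ (E4.ofTimeSpace 0 y)‖ ≤ B := by
    have hDψ : ContDiff ℝ ∞ (fderiv ℝ ψ) := (contDiff_infty_iff_fderiv.mp hψ).2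
    have hcont : Continuous fun y : E3 ↦ fderiv ℝ ψ (E4.ofTimeSpace 0 y) :=
      hDψ.continuous.comp (E4.continuous_ofTimeSpace 0)
    obtain ⟨B, hB⟩ :=
      (isCompact_closedBall (0 : E3) R).exists_bound_of_continuousOn hcont.continuousOn
    have hB0 : 0 ≤ B := (norm_nonneg _).trans (hB 0 (Metric.mem_closedBall_self hR.le))
    refine ⟨B, hB0, fun y ↦ ?_⟩
    by_cases hy : ‖y‖ ≤ R
    · exact hB y (mem_closedBall_zero_iff.2 hy)
    · rw [(hdata y (not_le.1 hy)).2, norm_zero]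
      exact hB0
  /- the constants `c = σ(S²) > 0` and `V = vol(B³)` -/
  have hc0 : 0 < ((volume : Measure E3).toSphere univ).toReal :=
    ENNReal.toReal_pos (Measure.measure_univ_ne_zero.mpr (Measure.toSphere_ne_zero _))
      (measure_ne_top _ _)
  refine ⟨(((volume : Measure E3).toSphere univ).toReal)⁻¹ *
    (162 * R ^ 2 * (volume (Metric.ball (0 : E3) 1)).toReal) * (A + 2 * B), fun t x ht ↦ ?_⟩
  have ht0 : 0 < t := by linarith
  have ht1 : 1 ≤ t := by linarith
  have hRt : R ≤ t := by linarith
  /- Kirchhoff's formula at the apex `(t, x)` with radius `t` (landed chain Darboux → spherical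
  means → Kirchhoff); the Duhamel term vanishes since `□_ηψ = 0` -/
  have hK := Kirchhoff.stub_kirchhoffFormula
    (SphericalMeans.stub_sphericalMeansCalculus Darboux.stub_sphereMeanDarboux) ψ hψ t x t ht0
  simp only [sub_self, hwave, integral_zero, mul_zero, intervalIntegral.integral_zero,
    sub_zero] at hK
  /- the directions seen from the apex: outside the cap `K` both data integrands vanish -/
  set K : Set (Metric.sphere (0 : E3) 1) := {w | ‖x + t • (w : E3)‖ ≤ R}
  have hKc : ∀ w : Metric.sphere (0 : E3) 1, w ∉ K →
      ψ (E4.ofTimeSpace 0 (x + t • (w : E3))) = 0 ∧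
        fderiv ℝ ψ (E4.ofTimeSpace 0 (x + t • (w : E3))) = 0 := fun w hw ↦
    hdata _ (not_le.1 hw)
  have hz1 : ∀ w : Metric.sphere (0 : E3) 1, w ∉ K →
      ψ (E4.ofTimeSpace 0 (x + t • (w : E3))) = 0 := fun w hw ↦ (hKc w hw).1
  have hz2 : ∀ w : Metric.sphere (0 : E3) 1, w ∉ K →
      fderiv ℝ ψ (E4.ofTimeSpace 0 (x + t • (w : E3))) (E4.ofTimeSpace 1 (w : E3)) = 0 :=
    fun w hw ↦ by rw [(hKc w hw).2, _root_.zero_apply]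
  set m : ℝ := ((volume : Measure E3).toSphere K).toReal with hmdef
  have hm0 : 0 ≤ m := ENNReal.toReal_nonneg
  have hm : m ≤ 162 * (R / t) ^ 2 * (volume (Metric.ball (0 : E3) 1)).toReal :=
    toSphere_focus_real_le x hR hRt
  /- `‖(1, w)‖ ≤ 2` for a unit vector `w` -/
  have h2 : ∀ w : Metric.sphere (0 : E3) 1, ‖E4.ofTimeSpace 1 (w : E3)‖ ≤ 2 := by
    intro w
    have hsq : ‖E4.ofTimeSpace 1 (w : E3)‖ ^ 2 = 1 ^ 2 + ‖(w : E3)‖ ^ 2 := by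
      rw [EuclideanSpace.norm_sq_eq, EuclideanSpace.norm_sq_eq, Fin.sum_univ_succ]
      simp [sq_abs]
    rw [norm_eq_of_mem_sphere w] at hsq
    nlinarith [norm_nonneg (E4.ofTimeSpace 1 (w : E3))]
  /- the two sphere integrals are `O(σ(K))` -/
  have I1 : |∫ w : Metric.sphere (0 : E3) 1, ψ (E4.ofTimeSpace 0 (x + t • (w : E3)))
      ∂(volume : Measure E3).toSphere| ≤ A * m := by
    rw [← setIntegral_eq_integral_of_forall_compl_eq_zero hz1, ← Real.norm_eq_abs, hmdef,
      ← measureReal_def]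
    exact norm_setIntegral_le_of_norm_le_const (measure_lt_top _ _) fun w _ ↦
      (Real.norm_eq_abs _).trans_le (hA _)
  have I2 : |∫ w : Metric.sphere (0 : E3) 1,
      fderiv ℝ ψ (E4.ofTimeSpace 0 (x + t • (w : E3))) (E4.ofTimeSpace 1 (w : E3))
      ∂(volume : Measure E3).toSphere| ≤ 2 * B * m := by
    rw [← setIntegral_eq_integral_of_forall_compl_eq_zero hz2, ← Real.norm_eq_abs, hmdef,
      ← measureReal_def]
    refine norm_setIntegral_le_of_norm_le_const (measure_lt_top _ _) fun w _ ↦ ?_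
    calc ‖fderiv ℝ ψ (E4.ofTimeSpace 0 (x + t • (w : E3))) (E4.ofTimeSpace 1 (w : E3))‖
        ≤ ‖fderiv ℝ ψ (E4.ofTimeSpace 0 (x + t • (w : E3)))‖ * ‖E4.ofTimeSpace 1 (w : E3)‖ :=
          ContinuousLinearMap.le_opNorm _ _
      _ ≤ B * 2 := mul_le_mul (hB _) (h2 w) (norm_nonneg _) hB0
      _ = 2 * B := mul_comm _ _
  /- assemble: `|ψ(t,x)| ≤ (A + 2tB) m / c`, `m t² ≤ 162 R² V`, `t ≥ 1` -/
  set c : ℝ := ((volume : Measure E3).toSphere univ).toReal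
  set V : ℝ := (volume (Metric.ball (0 : E3) 1)).toReal
  have key : |ψ (E4.ofTimeSpace t x)| ≤ c⁻¹ * (A * m) + t * (c⁻¹ * (2 * B * m)) := by
    rw [hK]
    refine (abs_add_le _ _).trans ?_
    rw [abs_mul, abs_mul, abs_mul, abs_of_pos (inv_pos.2 hc0), abs_of_pos ht0]
    exact add_le_add (mul_le_mul_of_nonneg_left I1 (inv_pos.2 hc0).le)
      (mul_le_mul_of_nonneg_left (mul_le_mul_of_nonneg_left I2 (inv_pos.2 hc0).le) ht0.le)
  have hM : m * t ^ 2 ≤ 162 * R ^ 2 * V := by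
    have h' : 162 * (R / t) ^ 2 * V = 162 * R ^ 2 * V / t ^ 2 := by
      rw [div_pow]
      ring
    rw [h', le_div_iff₀ (by positivity)] at hm
    exact hm
  have hM' : m * t ≤ 162 * R ^ 2 * V :=
    (mul_le_mul_of_nonneg_left (by nlinarith : t ≤ t ^ 2) hm0).trans hM
  rw [le_div_iff₀ ht0]
  calc |ψ (E4.ofTimeSpace t x)| * t ≤ (c⁻¹ * (A * m) + t * (c⁻¹ * (2 * B * m))) * t :=
        mul_le_mul_of_nonneg_right key ht0.le
    _ = c⁻¹ * (A * (m * t) + 2 * B * (m * t ^ 2)) := by ring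
    _ ≤ c⁻¹ * (A * (162 * R ^ 2 * V) + 2 * B * (162 * R ^ 2 * V)) :=
        mul_le_mul_of_nonneg_left (add_le_add (mul_le_mul_of_nonneg_left hM' hA0)
          (mul_le_mul_of_nonneg_left hM (mul_nonneg zero_le_two hB0))) (inv_pos.2 hc0).le
    _ = c⁻¹ * (162 * R ^ 2 * V) * (A + 2 * B) := by ring

end Summit.FinalStateConjecture.FinalStateConjecture.Theorems.NecksCertifyTwoCap.Dispersive

end
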